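/-
Copyright: statement-level skeleton of a published paper (lit-balaban cell, Phase-2 proof seat p18 gen 8). No proof claims
beyond what the kernel checks below.
-/
import Literature.MathematicalPhysics.QuantumFieldTheory.Balaban1983to89.B3Eq322OneLegDifferentiated
import Literature.MathematicalPhysics.QuantumFieldTheory.Balaban1983to89.B3Eq323EtaZeroTorus

/-!
# B3 — T. Bałaban, *(Higgs)₂,₃ quantum fields in a finite volume. III. Renormalization*, CMP **88** (1983) 411–445
[Balaban1983Higgs3], p. 439 [PDF 29], after **(3.22)**: *"The first graph on the right side has positive degree"* — PROVED
quantitatively as the (3.13)-type estimate of the first graph of the right side of (3.22) (the generalized graph *"+α … −(1+α)"*,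
`B3Eq322OneLegDifferentiated.rem322`) with the gain `(L^{j₁}η)^α`, and the whole analysis (3.21) → (3.22) → (3.23) of the
two-scalar-leg graphs with one leg differentiated DISCHARGED at the zero-field torus model instance (`d = 3`).  File 2 of 2 (companion of
`B3Eq322OneLegDifferentiated`, same seat).

statement-level skeleton of published theorems with citation tags; proofs where landed; nothing here is a claim about
the Yang–Mills mass gap

PDF held: `paper:balaban1983-higgs-2-3-quantum-fields-finite-volume` (journal page = PDF page + 410); pp. 436–439 [PDF 26–29] read
in the OCR text (`p0026.txt`–`p0029.txt`) and on the ×4 renders `…/1983-cmp88-higgs23-III-p028-x4.png`, `…-p029-x4.png`.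

CITATION HEADER (lean-in-tree rule).  Part of the lit-balaban TYPED SKELETON (HOME `run/shared/lean/pub/lit-balaban/`), PHASE 2,
seat p18 generation 8 (free-target protocol G.5-34(d)).  WHAT IS REPRODUCED: row **B3.Eq3.21-3.24** of `HOME/lit-balaban-r15/ROWS-B3.md`
(fold owner r15, referee ref-4), sub-display (3.22) and the sentence after it; the first graph of (3.21) at the instance.  CONSUMES BY
NAME, nothing re-proved: own `B3Eq322OneLegDifferentiated` (`expr321a`, `ker321`, `expr321b`, `rem322`, `eq322`, `sum_expr321b_eq`,
`expr321a_finset_sum`, `abs_expr321a_le`), r15's `B3Sect3ScalarSelfEnergy` (`d1Kernel`, `expr323`), p20 g2's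
`B3Taylor310Remainder.HolderDeriv` (the Hölder-α leg) and `B3Ineq313Pointwise.exp_split_half` (*"using half of the exponential factor
with index j₁"*), p20 g5's `B3Sect3KernelsZeroTorus.gpiece`/`gpiece_bounds` (the scale pieces `G^η_{(j)}` of the zero-field torus tower
with their (2.10)-type bounds), p20 g6's `B3Eq317ZeroTorus.G0xi_eq_rescaled` and `B3Eq323EtaZeroTorus.abs_expr323_eta_le_uniform` (the
(3.23) vertex has a bounded coefficient on the η-lattice), p39 g6's `B3GkZeroTorusRescaled.eta_mul_abs_G0xi_diag_le` (`ξ|G^ξ_k(0;y,y)| ≤ C`,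
the boundedness half of *"ηG_k(x,x) is convergent to some finite constant"*), `eta_pos` and `spacing_mul_eta`.

THE PRINTED TEXT (verbatim, p. 439).  *"The second expression is transformed in a way similar to (3.17) and (3.20): [(3.22)] The first
graph on the right side has positive degree, the second is treated in the same way as the expression (3.15): we sum over proper orderings
and j-indices and we get [(3.23)]."*  p. 438: *"The expression corresponding to the first graph is in fact convergent, because ηG_k(x,x)
is convergent to some finite constant as η → 0."*  p. 436 (the model estimate (3.13)/(3.14) and its mechanism): *"We can estimate the
factor ((L^{j₁}η)^{−1}dist(Δ(v),Δ(v′)))^{1+α} by O(1) using half of the exponential factor with index j₁."*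

WHAT IS PROVED, and how.
* §1 elementary: `u^αe^{−au/m} ≤ (1 + a⁻¹)m^α` (`rpow_mul_exp_le_scale`) and, with p20's half-split of the two exponential factors,
  the WEIGHT LEMMA `e^{−δu/s}e^{−δu/s′}u^α ≤ (1 + 2/δ)(min(s,s′))^α·e^{−½δu/s}e^{−½δu/s′}` (`exp_mul_rpow_le`) — the mechanism of
  *"positive degree"*: the Hölder weight `|x−x′|^α` of the leg costs `(L^{j₁}η)^α`, `j₁ = min(j,j′)`, against half of the decay.
* §2 **`abs_rem322_le`** — *"The first graph on the right side has positive degree"* quantitatively, in the POINTWISE form of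
  (3.13)/(3.14): under the (2.10)-type bounds `|(∂^η_μG_{(j)}(0))(x,x′)| ≤ C₁(L^jη)^{1−d}e^{−δ|x−x′|/L^jη}`,
  `|G_{(j′)}(x,x′)| ≤ C₂(L^{j′}η)^{2−d}e^{−δ|x−x′|/L^{j′}η}`, `|g|,|g′| ≤ 1`, `‖qw‖ ≤ Q‖w‖` and the Hölder-α derivative of the leg
  (`HolderDeriv η⁻¹ α H φ′`, `0 ≤ α ≤ 1`):
  `|rem322| ≤ d·C₁C₂Q²H(1 + 2/δ)·(L^{j₁}η)^α·Σ_{x,x′}η^{2d}‖φ(x)‖(L^jη)^{1−d}e^{−½δ|x−x′|/L^jη}(L^{j′}η)^{2−d}e^{−½δ|x−x′|/L^{j′}η}` — the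
  factors of a graph of degree `(1−d) + (2−d) + d + α = 3 − d + α`, `= α > 0` in `d = 3` (the class has degree 0, p. 438).
* §3 AT THE ZERO-FIELD TORUS MODEL INSTANCE (`A = B̃ = 0`, `Ω = T_η`, `d = 3`, lines = the tower pieces `gpiece`, `η = ε`):
  **`eq322_zero_torus`** — there are `δ, C, C₁, C₂ > 0` (functions of `L, a, m²`) such that for EVERY volume `P = (3,L,m,K)`, every
  `1 ≤ k ≤ K` (`k = j″`), all `q` (`‖qw‖ ≤ Q‖w‖`), `|g|,|g′| ≤ 1`, `g′` `K′`-Lipschitz, `φ`, Hölder-α `φ′`: (a) the chain identity for the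
  pieces, (b) the (3.23) vertex bound `|(3.23)| ≤ (C₁ + C₂K′)Σ_μΣ_xη³‖φ(x)‖‖q²(∂^η_μφ′)(x)‖` (p20 g6), (c) the estimate of §2 for EVERY
  piece `(j,j′)` with the kernel hypotheses DISCHARGED (`gpiece_bounds`); **`expr321a_zero_torus`** — graph (a) of (3.21) on the resummed
  propagator `G^η_k = Σ_{j<k}G^η_{(j)}`: `Σ_j expr321a[G^η_{(j)}] = expr321a[G^η_k]` and `|expr321a[G^η_k]| ≤ C·Σ_μΣ_xη³‖φ(x)‖‖q²(∂^η_μφ′)(x)‖`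
  (`ηG^η_k(x,x) = ξG^ξ_k(0;y,y)` in `d = 3`, `eps_mul_sum_gpiece_diag`, bounded by p39's constant uniformly in the volume and the scale).
HONEST SCOPE: §§1–2 hold for every `d` under the displayed (2.10)-type kernel HYPOTHESES (rows B3.Eq2.10–2.12: at the print's generality
`Ω ⊊ T_η`, `B̃ ≠ 0` they are consequences of [Balaban1982Higgs1] Props. 2.1/2.3, not proved here); §3 is `d = 3`, zero external field,
the whole torus, fixed `a > 0`, `m² ≥ 0`, constants existential; the volume sum `Σ_{x,x′}η^{2d}` is not resolved into the cube-localized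
display of (3.13) (that localization is p20 g5's `B3Ineq314Cubes.sum_sum_le_cubes`, applicable verbatim); the LIMIT `ηG_k(x,x) → const` is
not claimed.  D-0026: theorems only, no new definitions, no named facts, no `sorry`; standard axioms.  Unit `lit-balaban-p18-g8`
(literature-prover-lit-balaban-p18-g8-0), HOME `run/shared/lean/pub/lit-balaban/`, 2026-08-21.
-/

open scoped BigOperators RealInnerProductSpace

namespace Literature.MathematicalPhysics.QuantumFieldTheory.Balaban1983to89.B3Eq322PositiveDegree

open Finset LatticeFieldCalculus B3Sect3ScalarSelfEnergy B3Taylor310Remainder B3Ineq313Pointwise B3Resummation315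
open B3Sect3KernelsZeroTorus B3GkZeroTorusRescaled B3Eq317ZeroTorus B3Eq323EtaZeroTorus B3Eq322OneLegDifferentiated

noncomputable section

universe u

/-! ## §1 Elementary: the Hölder weight against half of the exponential decay -/

section Elementary

/-- kernel: `t^α ≤ 1 + t` for `t ≥ 0`, `0 ≤ α ≤ 1`. [folklore] -/
private theorem rpow_le_one_add {t α : ℝ} (ht : 0 ≤ t) (hα0 : 0 ≤ α) (hα1 : α ≤ 1) : t ^ α ≤ 1 + t := by
  rcases le_total t 1 with h1 | h1
  · exact (Real.rpow_le_one ht h1 hα0).trans (by linarith)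
  · calc t ^ α ≤ t ^ (1 : ℝ) := Real.rpow_le_rpow_of_exponent_le h1 hα1
      _ = t := Real.rpow_one t
      _ ≤ 1 + t := by linarith

/-- kernel: `t·e^{−at} ≤ a⁻¹` for `a > 0` (from `1 + at ≤ e^{at}`). [folklore] -/
private theorem mul_exp_neg_le_inv {a : ℝ} (ha : 0 < a) (t : ℝ) : t * Real.exp (-(a * t)) ≤ a⁻¹ := by
  have h1 : a * t + 1 ≤ Real.exp (a * t) := Real.add_one_le_exp _
  have h2 : Real.exp (a * t) * Real.exp (-(a * t)) = 1 := by rw [← Real.exp_add, add_neg_cancel, Real.exp_zero]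
  have h3 : 0 < Real.exp (-(a * t)) := Real.exp_pos _
  have key : a * (t * Real.exp (-(a * t))) ≤ 1 := by nlinarith [mul_le_mul_of_nonneg_right h1 h3.le]
  calc t * Real.exp (-(a * t)) = a⁻¹ * (a * (t * Real.exp (-(a * t)))) := by
        rw [← mul_assoc, inv_mul_cancel₀ ha.ne', one_mul]
    _ ≤ a⁻¹ * 1 := mul_le_mul_of_nonneg_left key (inv_nonneg.mpr ha.le)
    _ = a⁻¹ := mul_one _

/-- kernel: `t^α·e^{−at} ≤ 1 + a⁻¹` (`t ≥ 0`, `0 ≤ α ≤ 1`, `a > 0`). [folklore] -/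
private theorem rpow_mul_exp_le {t α a : ℝ} (ht : 0 ≤ t) (hα0 : 0 ≤ α) (hα1 : α ≤ 1) (ha : 0 < a) :
    t ^ α * Real.exp (-(a * t)) ≤ 1 + a⁻¹ := by
  have he : Real.exp (-(a * t)) ≤ 1 := by
    rw [Real.exp_le_one_iff]
    nlinarith [mul_nonneg ha.le ht]
  calc t ^ α * Real.exp (-(a * t)) ≤ (1 + t) * Real.exp (-(a * t)) :=
        mul_le_mul_of_nonneg_right (rpow_le_one_add ht hα0 hα1) (Real.exp_pos _).le
    _ = Real.exp (-(a * t)) + t * Real.exp (-(a * t)) := by ring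
    _ ≤ 1 + a⁻¹ := add_le_add he (mul_exp_neg_le_inv ha t)

/-- p. 439 [PDF 29], *"The first graph on the right side has positive degree"* — the elementary mechanism: the Hölder weight `|x−x′|^α`
against an exponential factor of scale `m` costs `m^α`: `u^α·e^{−a u/m} ≤ (1 + a⁻¹)·m^α` (`u ≥ 0`, `m > 0`, `0 ≤ α ≤ 1`, `a > 0`).
[cite: Balaban1983Higgs3, (3.22) p.439] -/
theorem rpow_mul_exp_le_scale {u α a m : ℝ} (hu : 0 ≤ u) (hα0 : 0 ≤ α) (hα1 : α ≤ 1) (ha : 0 < a) (hm : 0 < m) :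
    u ^ α * Real.exp (-(a * m⁻¹ * u)) ≤ (1 + a⁻¹) * m ^ α := by
  have ht : 0 ≤ m⁻¹ * u := mul_nonneg (inv_nonneg.mpr hm.le) hu
  have key := rpow_mul_exp_le ht hα0 hα1 ha
  have hu' : u = m * (m⁻¹ * u) := by rw [← mul_assoc, mul_inv_cancel₀ hm.ne', one_mul]
  have hpow : u ^ α = m ^ α * (m⁻¹ * u) ^ α := by
    rw [← Real.mul_rpow hm.le ht, ← hu']
  calc u ^ α * Real.exp (-(a * m⁻¹ * u))
      = m ^ α * ((m⁻¹ * u) ^ α * Real.exp (-(a * (m⁻¹ * u)))) := by rw [hpow, mul_assoc a]; ring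
    _ ≤ m ^ α * (1 + a⁻¹) := mul_le_mul_of_nonneg_left key (Real.rpow_nonneg hm.le _)
    _ = (1 + a⁻¹) * m ^ α := mul_comm _ _

/-- p. 439 [PDF 29] with p. 436 *"using half of the exponential factor with index j₁"*, `j₁ = min{j,j′}`: the WEIGHT LEMMA of the
first graph of (3.22) — `e^{−δu/s}e^{−δu/s′}·u^α ≤ (1 + 2/δ)·(min(s,s′))^α·e^{−½δu/s}e^{−½δu/s′}` (`u ≥ 0`, `s, s′ > 0`, `0 ≤ α ≤ 1`).
[cite: Balaban1983Higgs3, (3.22) p.439] -/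
theorem exp_mul_rpow_le {δ s s' u α : ℝ} (hδ : 0 < δ) (hs : 0 < s) (hs' : 0 < s') (hu : 0 ≤ u) (hα0 : 0 ≤ α)
    (hα1 : α ≤ 1) :
    Real.exp (-(δ * s⁻¹ * u)) * Real.exp (-(δ * s'⁻¹ * u)) * u ^ α ≤
      (1 + 2 / δ) * (min s s') ^ α * (Real.exp (-(δ / 2 * s⁻¹ * u)) * Real.exp (-(δ / 2 * s'⁻¹ * u))) := by
  have hm : 0 < min s s' := lt_min hs hs'
  have h1 := exp_split_half hδ hs hs' hu
  have h2 := rpow_mul_exp_le_scale hu hα0 hα1 (half_pos hδ) hm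
  have hconst : (1 + (δ / 2)⁻¹) = 1 + 2 / δ := by rw [inv_div]
  rw [hconst] at h2
  have hE : 0 ≤ Real.exp (-(δ / 2 * s⁻¹ * u)) * Real.exp (-(δ / 2 * s'⁻¹ * u)) := by positivity
  calc Real.exp (-(δ * s⁻¹ * u)) * Real.exp (-(δ * s'⁻¹ * u)) * u ^ α
      ≤ Real.exp (-(δ / 2 * (min s s')⁻¹ * u)) * (Real.exp (-(δ / 2 * s⁻¹ * u)) * Real.exp (-(δ / 2 * s'⁻¹ * u)))
          * u ^ α := mul_le_mul_of_nonneg_right h1 (Real.rpow_nonneg hu _)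
    _ = (u ^ α * Real.exp (-(δ / 2 * (min s s')⁻¹ * u)))
          * (Real.exp (-(δ / 2 * s⁻¹ * u)) * Real.exp (-(δ / 2 * s'⁻¹ * u))) := by ring
    _ ≤ ((1 + 2 / δ) * (min s s') ^ α)
          * (Real.exp (-(δ / 2 * s⁻¹ * u)) * Real.exp (-(δ / 2 * s'⁻¹ * u))) := mul_le_mul_of_nonneg_right h2 hE

end Elementary

/-! ## §2 "The first graph on the right side has positive degree": the (3.13)-type pointwise estimate of `rem322` -/

section Bound

variable {P : Params} {j : ℕ} {W : Type*} [NormedAddCommGroup W] [InnerProductSpace ℝ W]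

/-- kernel: `|φ(x)·q(qv)| ≤ ‖φ(x)‖·Q²·‖v‖` when `‖qw‖ ≤ Q‖w‖`. [folklore] -/
private theorem abs_inner_qq_le {Q : ℝ} (hQ : 0 ≤ Q) (q : W →ₗ[ℝ] W) (hq : ∀ w : W, ‖q w‖ ≤ Q * ‖w‖) (a v : W) :
    |⟪a, q (q v)⟫| ≤ ‖a‖ * (Q ^ 2 * ‖v‖) := by
  calc |⟪a, q (q v)⟫| ≤ ‖a‖ * ‖q (q v)‖ := abs_real_inner_le_norm _ _
    _ ≤ ‖a‖ * (Q ^ 2 * ‖v‖) := by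
        refine mul_le_mul_of_nonneg_left ?_ (norm_nonneg _)
        calc ‖q (q v)‖ ≤ Q * ‖q v‖ := hq _
          _ ≤ Q * (Q * ‖v‖) := mul_le_mul_of_nonneg_left (hq v) hQ
          _ = Q ^ 2 * ‖v‖ := by ring

/-- kernel: the kernel of the second graph of (3.21) under the (2.10)-type bounds — `|k_μ(x,x′)| ≤ C₁s^{1−d}e^{−δu/s}·C₂s′^{2−d}e^{−δu/s′}`,
`u = |x−x′| = η·tdist`, `|g|,|g′| ≤ 1` (one differentiation on the scalar line: the factor `(L^jη)^{−1}` of (2.10)).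
[cite: Balaban1983Higgs3, (2.10) p.426, (3.22) p.439] -/
theorem abs_ker321_le {η C₁ C₂ δ s s' : ℝ} {G0 Gj : Kernel P j} {g g' : SiteField P j ℝ} {μ : Fin P.d}
    (hg : ∀ x, |g x| ≤ 1) (hg' : ∀ x, |g' x| ≤ 1)
    (hG0 : ∀ x x' : Site P j,
      |d1Kernel η⁻¹ μ G0 x x'| ≤ C₁ * s ^ ((1 : ℝ) - (P.d : ℝ)) * Real.exp (-(δ * s⁻¹ * (η * Site.tdist x x'))))
    (hGj : ∀ x x' : Site P j,
      |Gj x x'| ≤ C₂ * s' ^ ((2 : ℝ) - (P.d : ℝ)) * Real.exp (-(δ * s'⁻¹ * (η * Site.tdist x x'))))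
    (x x' : Site P j) :
    |ker321 η μ G0 Gj g g' x x'| ≤
      (C₁ * s ^ ((1 : ℝ) - (P.d : ℝ)) * Real.exp (-(δ * s⁻¹ * (η * Site.tdist x x')))) *
        (C₂ * s' ^ ((2 : ℝ) - (P.d : ℝ)) * Real.exp (-(δ * s'⁻¹ * (η * Site.tdist x x')))) := by
  have hA : 0 ≤ C₁ * s ^ ((1 : ℝ) - (P.d : ℝ)) * Real.exp (-(δ * s⁻¹ * (η * Site.tdist x x'))) :=
    (abs_nonneg _).trans (hG0 x x')
  have hB : 0 ≤ C₂ * s' ^ ((2 : ℝ) - (P.d : ℝ)) * Real.exp (-(δ * s'⁻¹ * (η * Site.tdist x x'))) :=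
    (abs_nonneg _).trans (hGj x x')
  have h1 := hg x
  have h2 := hGj x x'
  have h3 := hg' x'
  have h4 := hG0 x x'
  unfold ker321
  rw [abs_mul, abs_mul, abs_mul]
  calc |d1Kernel η⁻¹ μ G0 x x'| * |g x| * |Gj x x'| * |g' x'|
      ≤ (C₁ * s ^ ((1 : ℝ) - (P.d : ℝ)) * Real.exp (-(δ * s⁻¹ * (η * Site.tdist x x')))) * 1
          * (C₂ * s' ^ ((2 : ℝ) - (P.d : ℝ)) * Real.exp (-(δ * s'⁻¹ * (η * Site.tdist x x')))) * 1 := by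
        gcongr
    _ = _ := by ring

/-- **p. 439 [PDF 29], "The first graph on the right side has positive degree" — PROVED quantitatively, in the POINTWISE form of
(3.13)/(3.14)** (before the localization of the vertices into cubes): under the (2.10)-type bounds on the two lines at the scales
`s = L^jη` (the differentiated scalar line `G_{(j)}(0)`: `C₁s^{1−d}e^{−δ|x−x′|/s}`), `s′ = L^{j′}η` (the vector line: `C₂s′^{2−d}e^{−δ|x−x′|/s′}`),
localizations `|g|,|g′| ≤ 1`, charge matrix `‖qw‖ ≤ Q‖w‖` and the Hölder hypothesis `‖(∂^η_μφ′)(z) − (∂^η_μφ′)(z′)‖ ≤ H|z−z′|^α`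
(`0 ≤ α ≤ 1`) on the differentiated leg:
`|rem322| ≤ d·C₁C₂Q²H(1 + 2/δ)·(min(s,s′))^α·Σ_{x,x′}η^{2d}‖φ(x)‖·s^{1−d}e^{−½δ|x−x′|/s}·s′^{2−d}e^{−½δ|x−x′|/s′}` — the factors of a
generalized graph of degree `3 − d + α` (`= α > 0` in `d = 3`), the gain `(L^{j₁}η)^α`, `j₁ = min(j,j′)`, paid by half of the decay.
[cite: Balaban1983Higgs3, (3.22) p.439] -/
theorem abs_rem322_le (η : ℝ) (hη : 0 < η) {α H Q C₁ C₂ δ s s' : ℝ} (hα0 : 0 ≤ α) (hα1 : α ≤ 1) (hH : 0 ≤ H) (hQ : 0 ≤ Q)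
    (hδ : 0 < δ) (hs : 0 < s) (hs' : 0 < s') (q : W →ₗ[ℝ] W) (hq : ∀ w : W, ‖q w‖ ≤ Q * ‖w‖)
    (G0 Gj : Kernel P j) (g g' : SiteField P j ℝ) (hg : ∀ x, |g x| ≤ 1) (hg' : ∀ x, |g' x| ≤ 1)
    (hG0 : ∀ (μ : Fin P.d) (x x' : Site P j),
      |d1Kernel η⁻¹ μ G0 x x'| ≤ C₁ * s ^ ((1 : ℝ) - (P.d : ℝ)) * Real.exp (-(δ * s⁻¹ * (η * Site.tdist x x'))))
    (hGj : ∀ x x' : Site P j,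
      |Gj x x'| ≤ C₂ * s' ^ ((2 : ℝ) - (P.d : ℝ)) * Real.exp (-(δ * s'⁻¹ * (η * Site.tdist x x'))))
    (φ φ' : SiteField P j W) (hφ' : HolderDeriv η⁻¹ α H φ') :
    |rem322 η q G0 Gj g g' φ φ'| ≤
      P.d * C₁ * C₂ * Q ^ 2 * H * (1 + 2 / δ) * (min s s') ^ α *
        ∑ x : Site P j, ∑ x' : Site P j, η ^ (2 * P.d) *
          (‖φ x‖ * (s ^ ((1 : ℝ) - (P.d : ℝ)) * Real.exp (-(δ / 2 * s⁻¹ * (η * Site.tdist x x'))))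
            * (s' ^ ((2 : ℝ) - (P.d : ℝ)) * Real.exp (-(δ / 2 * s'⁻¹ * (η * Site.tdist x x'))))) := by
  have hC₁ : 0 ≤ C₁ := by
    have h := (abs_nonneg _).trans (hG0 ⟨0, P.hd⟩ default default)
    have hpos : 0 < s ^ ((1 : ℝ) - (P.d : ℝ)) *
        Real.exp (-(δ * s⁻¹ * (η * Site.tdist (default : Site P j) default))) :=
      mul_pos (Real.rpow_pos_of_pos hs _) (Real.exp_pos _)
    rw [mul_assoc] at h
    exact nonneg_of_mul_nonneg_left h hpos
  have hC₂ : 0 ≤ C₂ := by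
    have h := (abs_nonneg _).trans (hGj default default)
    have hpos : 0 < s' ^ ((2 : ℝ) - (P.d : ℝ)) *
        Real.exp (-(δ * s'⁻¹ * (η * Site.tdist (default : Site P j) default))) :=
      mul_pos (Real.rpow_pos_of_pos hs' _) (Real.exp_pos _)
    rw [mul_assoc] at h
    exact nonneg_of_mul_nonneg_left h hpos
  -- the constant without the factor `d` (which comes from the sum over `μ`) and the per-term bound
  set K : ℝ := C₁ * C₂ * Q ^ 2 * H * (1 + 2 / δ) * (min s s') ^ α with hK
  have hK0 : 0 ≤ K := by
    rw [hK]
    have : 0 ≤ (min s s') ^ α := Real.rpow_nonneg (lt_min hs hs').le _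
    positivity
  set S : ℝ := ∑ x : Site P j, ∑ x' : Site P j, η ^ (2 * P.d) *
      (‖φ x‖ * (s ^ ((1 : ℝ) - (P.d : ℝ)) * Real.exp (-(δ / 2 * s⁻¹ * (η * Site.tdist x x'))))
        * (s' ^ ((2 : ℝ) - (P.d : ℝ)) * Real.exp (-(δ / 2 * s'⁻¹ * (η * Site.tdist x x'))))) with hS
  have hterm : ∀ (μ : Fin P.d) (x x' : Site P j),
      |η ^ (2 * P.d) * (ker321 η μ G0 Gj g g' x x' * ⟪φ x, q (q (pdiff η⁻¹ μ φ' x' - pdiff η⁻¹ μ φ' x))⟫)| ≤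
        K * (η ^ (2 * P.d) * (‖φ x‖ * (s ^ ((1 : ℝ) - (P.d : ℝ)) * Real.exp (-(δ / 2 * s⁻¹ * (η * Site.tdist x x'))))
          * (s' ^ ((2 : ℝ) - (P.d : ℝ)) * Real.exp (-(δ / 2 * s'⁻¹ * (η * Site.tdist x x')))))) := by
    intro μ x x'
    set u : ℝ := η * Site.tdist x x' with hu
    have hu0 : 0 ≤ u := mul_nonneg hη.le (Nat.cast_nonneg _)
    -- the leg: a differentiation of the order 1 + α
    have hleg : ‖pdiff η⁻¹ μ φ' x' - pdiff η⁻¹ μ φ' x‖ ≤ H * u ^ α := by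
      have h := hφ' μ x x'
      rw [inv_inv] at h
      rwa [norm_sub_rev]
    have hinner : |⟪φ x, q (q (pdiff η⁻¹ μ φ' x' - pdiff η⁻¹ μ φ' x))⟫| ≤ ‖φ x‖ * (Q ^ 2 * (H * u ^ α)) :=
      (abs_inner_qq_le hQ q hq _ _).trans
        (mul_le_mul_of_nonneg_left (mul_le_mul_of_nonneg_left hleg (sq_nonneg _)) (norm_nonneg _))
    have hker := abs_ker321_le (μ := μ) hg hg' (hG0 μ) hGj x x'
    have hA : 0 ≤ C₁ * s ^ ((1 : ℝ) - (P.d : ℝ)) * Real.exp (-(δ * s⁻¹ * u)) := by positivity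
    have hB : 0 ≤ C₂ * s' ^ ((2 : ℝ) - (P.d : ℝ)) * Real.exp (-(δ * s'⁻¹ * u)) := by positivity
    have hweight := exp_mul_rpow_le hδ hs hs' hu0 hα0 hα1
    have hX : 0 ≤ η ^ (2 * P.d) * (C₁ * s ^ ((1 : ℝ) - (P.d : ℝ)) * (C₂ * s' ^ ((2 : ℝ) - (P.d : ℝ))) *
        (‖φ x‖ * Q ^ 2 * H)) := by positivity
    calc |η ^ (2 * P.d) * (ker321 η μ G0 Gj g g' x x' * ⟪φ x, q (q (pdiff η⁻¹ μ φ' x' - pdiff η⁻¹ μ φ' x))⟫)|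
        = η ^ (2 * P.d) * (|ker321 η μ G0 Gj g g' x x'| *
            |⟪φ x, q (q (pdiff η⁻¹ μ φ' x' - pdiff η⁻¹ μ φ' x))⟫|) := by
          rw [abs_mul, abs_mul, abs_of_nonneg (by positivity : (0:ℝ) ≤ η ^ (2 * P.d))]
      _ ≤ η ^ (2 * P.d) * (((C₁ * s ^ ((1 : ℝ) - (P.d : ℝ)) * Real.exp (-(δ * s⁻¹ * u))) *
            (C₂ * s' ^ ((2 : ℝ) - (P.d : ℝ)) * Real.exp (-(δ * s'⁻¹ * u)))) * (‖φ x‖ * (Q ^ 2 * (H * u ^ α)))) := by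
          refine mul_le_mul_of_nonneg_left ?_ (by positivity)
          exact mul_le_mul hker hinner (abs_nonneg _) (mul_nonneg hA hB)
      _ = η ^ (2 * P.d) * (C₁ * s ^ ((1 : ℝ) - (P.d : ℝ)) * (C₂ * s' ^ ((2 : ℝ) - (P.d : ℝ))) * (‖φ x‖ * Q ^ 2 * H))
            * (Real.exp (-(δ * s⁻¹ * u)) * Real.exp (-(δ * s'⁻¹ * u)) * u ^ α) := by ring
      _ ≤ η ^ (2 * P.d) * (C₁ * s ^ ((1 : ℝ) - (P.d : ℝ)) * (C₂ * s' ^ ((2 : ℝ) - (P.d : ℝ))) * (‖φ x‖ * Q ^ 2 * H))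
            * ((1 + 2 / δ) * (min s s') ^ α *
              (Real.exp (-(δ / 2 * s⁻¹ * u)) * Real.exp (-(δ / 2 * s'⁻¹ * u)))) :=
          mul_le_mul_of_nonneg_left hweight hX
      _ = K * (η ^ (2 * P.d) * (‖φ x‖ * (s ^ ((1 : ℝ) - (P.d : ℝ)) * Real.exp (-(δ / 2 * s⁻¹ * u)))
          * (s' ^ ((2 : ℝ) - (P.d : ℝ)) * Real.exp (-(δ / 2 * s'⁻¹ * u))))) := by rw [hK]; ring
  -- summation: each `μ`-slice is bounded by `K·S`, and there are `d` directions
  have hslice : ∀ μ : Fin P.d,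
      |∑ x : Site P j, ∑ x' : Site P j, η ^ (2 * P.d) *
          (ker321 η μ G0 Gj g g' x x' * ⟪φ x, q (q (pdiff η⁻¹ μ φ' x' - pdiff η⁻¹ μ φ' x))⟫)| ≤ K * S := by
    intro μ
    calc |∑ x : Site P j, ∑ x' : Site P j, η ^ (2 * P.d) *
            (ker321 η μ G0 Gj g g' x x' * ⟪φ x, q (q (pdiff η⁻¹ μ φ' x' - pdiff η⁻¹ μ φ' x))⟫)|
        ≤ ∑ x : Site P j, |∑ x' : Site P j, η ^ (2 * P.d) *
            (ker321 η μ G0 Gj g g' x x' * ⟪φ x, q (q (pdiff η⁻¹ μ φ' x' - pdiff η⁻¹ μ φ' x))⟫)| :=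
          Finset.abs_sum_le_sum_abs _ _
      _ ≤ ∑ x : Site P j, ∑ x' : Site P j, |η ^ (2 * P.d) *
            (ker321 η μ G0 Gj g g' x x' * ⟪φ x, q (q (pdiff η⁻¹ μ φ' x' - pdiff η⁻¹ μ φ' x))⟫)| :=
          Finset.sum_le_sum fun x _ => Finset.abs_sum_le_sum_abs _ _
      _ ≤ ∑ x : Site P j, ∑ x' : Site P j, K * (η ^ (2 * P.d) * (‖φ x‖
            * (s ^ ((1 : ℝ) - (P.d : ℝ)) * Real.exp (-(δ / 2 * s⁻¹ * (η * Site.tdist x x'))))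
            * (s' ^ ((2 : ℝ) - (P.d : ℝ)) * Real.exp (-(δ / 2 * s'⁻¹ * (η * Site.tdist x x')))))) :=
          Finset.sum_le_sum fun x _ => Finset.sum_le_sum fun x' _ => hterm μ x x'
      _ = K * S := by
          rw [hS, Finset.mul_sum]
          exact Finset.sum_congr rfl fun x _ => by rw [Finset.mul_sum]
  unfold rem322
  calc |∑ μ : Fin P.d, ∑ x : Site P j, ∑ x' : Site P j, η ^ (2 * P.d) *
          (ker321 η μ G0 Gj g g' x x' * ⟪φ x, q (q (pdiff η⁻¹ μ φ' x' - pdiff η⁻¹ μ φ' x))⟫)|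
      ≤ ∑ μ : Fin P.d, |∑ x : Site P j, ∑ x' : Site P j, η ^ (2 * P.d) *
          (ker321 η μ G0 Gj g g' x x' * ⟪φ x, q (q (pdiff η⁻¹ μ φ' x' - pdiff η⁻¹ μ φ' x))⟫)| :=
        Finset.abs_sum_le_sum_abs _ _
    _ ≤ ∑ _μ : Fin P.d, K * S := Finset.sum_le_sum fun μ _ => hslice μ
    _ = P.d * (K * S) := by rw [Finset.sum_const, Finset.card_univ, Fintype.card_fin, nsmul_eq_mul]
    _ = P.d * C₁ * C₂ * Q ^ 2 * H * (1 + 2 / δ) * (min s s') ^ α * S := by rw [hK]; ring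

end Bound

/-! ## §3 At the zero-field torus model instance (`d = 3`, `A = B̃ = 0`, `Ω = T_η`) -/

section ZeroTorus

variable {P : Params}

/-- p. 438, graph (a) of (3.21) on the η-lattice, `d = 3`: the loop factor on the resummed zero-field torus propagator equals the
rescaled diagonal, `ε·G^η_k(x,x) = ξ·G^ξ_k(0;x,x)` (`G^ξ_k(0) = (L^kε)·G^η_k` in `d = 3`, `ξ·L^kε = ε`). [cite: Balaban1983Higgs3, (3.21) p.438] -/
theorem eps_mul_sum_gpiece_diag {a msq : ℝ} (ha : 0 < a) (hm : 0 ≤ msq) (hd : P.d = 3) {k : ℕ} (hk : 1 ≤ k) (x : Site P 0) :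
    P.eps * (∑ i ∈ range k, gpiece P a msq k i) x x = P.eta k * G0xi P a msq k x x := by
  have h32 : P.spacing k ^ (P.d - 2) = P.spacing k := by rw [hd]; norm_num
  rw [G0xi_eq_rescaled ha hm (by omega) hk, h32, ← spacing_mul_eta P k]
  ring

/-- **(3.21) p. 438, the FIRST graph AT THE ZERO-FIELD TORUS MODEL INSTANCE, `d = 3`** — *"The expression corresponding to the first
graph is in fact convergent, because ηG_k(x,x) is convergent to some finite constant as η → 0"* (boundedness half): for odd `L > 1`,
`a > 0`, `m² ≥ 0` there is `C > 0` such that for EVERY volume `P = (3,L,m,K)`, every `1 ≤ k ≤ K` and all `q`, `|g| ≤ 1`, `φ`, `φ′`: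
(i) the expressions on the pieces `G^η_{(i)}` sum to the expression on `G^η_k = Σ_{i<k}G^η_{(i)}`, and (ii)
`|expr321a[G^η_k]| ≤ C·Σ_μΣ_xη³‖φ(x)‖‖q²(∂^η_μφ′)(x)‖` — a local vertex with a bounded function, uniformly in the volume and the scale
(p39 g6's `ξ|G^ξ_k(0;y,y)| ≤ C` transported by `eps_mul_sum_gpiece_diag`). [cite: Balaban1983Higgs3, (3.21) p.438] -/
theorem expr321a_zero_torus (L : ℕ) (hL : Odd L ∧ 1 < L) {a : ℝ} (ha : 0 < a) {msq : ℝ} (hmsq : 0 ≤ msq) :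
    ∃ C : ℝ, 0 < C ∧ ∀ (P : Params), P.d = 3 → P.L = L → ∀ k : ℕ, 1 ≤ k → k ≤ P.K →
      ∀ {W : Type u} [NormedAddCommGroup W] [InnerProductSpace ℝ W] (q : W →ₗ[ℝ] W) (g : SiteField P 0 ℝ)
        (φ φ' : SiteField P 0 W), (∀ x, |g x| ≤ 1) →
        (∑ i ∈ range k, expr321a P.eps q (gpiece P a msq k i) g φ φ' =
            expr321a P.eps q (∑ i ∈ range k, gpiece P a msq k i) g φ φ') ∧
        |expr321a P.eps q (∑ i ∈ range k, gpiece P a msq k i) g φ φ'| ≤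
          C * ∑ μ : Fin P.d, ∑ x : Site P 0, P.eps ^ P.d * (‖φ x‖ * ‖q (q (pdiff P.eps⁻¹ μ φ' x))‖) := by
  obtain ⟨C, hC, H⟩ := eta_mul_abs_G0xi_diag_le L hL ha hmsq
  refine ⟨C, hC, fun P hPd hPL k hk1 hkK W _ _ q g φ φ' hg => ⟨?_, ?_⟩⟩
  · exact (expr321a_finset_sum (range k) P.eps q (fun i => gpiece P a msq k i) g φ φ').symm
  · refine abs_expr321a_le P.eps_pos.le q _ g (fun x => ?_) φ φ'
    have hdiag := H P hPd hPL k hk1 hkK x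
    have hη : 0 ≤ P.eta k := (eta_pos P k).le
    rw [abs_mul, eps_mul_sum_gpiece_diag ha hmsq hPd hk1 x, abs_mul, abs_of_nonneg hη]
    calc P.eta k * |G0xi P a msq k x x| * |g x| ≤ C * 1 :=
          mul_le_mul hdiag (hg x) (abs_nonneg _) hC.le
      _ = C := mul_one C

/-- **(3.22)–(3.23) p. 439 AT THE ZERO-FIELD TORUS MODEL INSTANCE, `d = 3`** — the analysis of the second graph of (3.21) END TO END
for the lines `G_{(j)}(0) = G_{(j′)} = G^η_{(j)}` of Bałaban's scalar torus tower (`A = B̃ = 0`, `Ω = T_η`, `η = ε`): for odd `L > 1`,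
`a > 0`, `m² ≥ 0` there are `δ, C, C₁, C₂ > 0` (functions of `L, a, m²`) such that for EVERY volume `P = (3,L,m,K)`, every `1 ≤ k ≤ K`
(`k = j″`), every charge matrix (`‖qw‖ ≤ Q‖w‖`), localizations `|g|,|g′| ≤ 1` with `g′` `K′`-Lipschitz (`|g′(x′) − g′(x)| ≤ K′·ε|x−x′|₁`,
the p. 439 splitting), every field `φ` and Hölder-α leg `φ′` (`0 ≤ α ≤ 1`):
(a) `Σ_{j,j′<k}expr321b[G^η_{(j)},G^η_{(j′)}] = Σ_{j,j′<k}rem322[j,j′] + (3.23)[G^η_k(0),G^η_k]` ((3.22) then the summation over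
orderings and indices); (b) the vertex (3.23) has a bounded function: `|(3.23)| ≤ (C₁ + C₂K′)·Σ_μΣ_xη³‖φ(x)‖‖q²(∂^η_μφ′)(x)‖`
(p20 g6); (c) every piece `(j,j′)` of the first graph of (3.22) obeys the estimate of `abs_rem322_le` with the kernel hypotheses
DISCHARGED (`gpiece_bounds`): `|rem322[j,j′]| ≤ d·C²Q²H(1+2/δ)(L^{j₁}η)^α·Σ_{x,x′}η^{2d}‖φ(x)‖(L^jη)^{1−d}e^{−½δ|x−x′|/L^jη}(L^{j′}η)^{2−d}
e^{−½δ|x−x′|/L^{j′}η}` — positive degree `α`. [cite: Balaban1983Higgs3, (3.22)–(3.23) p.439] -/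
theorem eq322_zero_torus (L : ℕ) (hL : Odd L ∧ 1 < L) {a : ℝ} (ha : 0 < a) {msq : ℝ} (hmsq : 0 ≤ msq) :
    ∃ δ C C₁ C₂ : ℝ, 0 < δ ∧ 0 < C ∧ 0 < C₁ ∧ 0 < C₂ ∧ ∀ (P : Params), P.d = 3 → P.L = L → ∀ k : ℕ, 1 ≤ k → k ≤ P.K →
      ∀ {W : Type u} [NormedAddCommGroup W] [InnerProductSpace ℝ W] {α H Q K' : ℝ}, 0 ≤ α → α ≤ 1 → 0 ≤ H → 0 ≤ Q →
        0 ≤ K' → ∀ (q : W →ₗ[ℝ] W), (∀ w : W, ‖q w‖ ≤ Q * ‖w‖) →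
        ∀ (g g' : SiteField P 0 ℝ), (∀ x, |g x| ≤ 1) → (∀ x, |g' x| ≤ 1) →
        (∀ x x' : Site P 0, |g' x' - g' x| ≤ K' * (P.eps * Site.tdist x x')) →
        ∀ (φ φ' : SiteField P 0 W), HolderDeriv (P.eps)⁻¹ α H φ' →
          (∑ i ∈ range k, ∑ i' ∈ range k, expr321b P.eps q (gpiece P a msq k i) (gpiece P a msq k i') g g' φ φ' =
              (∑ i ∈ range k, ∑ i' ∈ range k, rem322 P.eps q (gpiece P a msq k i) (gpiece P a msq k i') g g' φ φ') +
                expr323 P.eps q (∑ i ∈ range k, gpiece P a msq k i) (∑ i ∈ range k, gpiece P a msq k i) g g' φ φ') ∧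
          |expr323 P.eps q (∑ i ∈ range k, gpiece P a msq k i) (∑ i ∈ range k, gpiece P a msq k i) g g' φ φ'| ≤
            (C₁ + C₂ * K') * ∑ μ : Fin P.d, ∑ x : Site P 0, P.eps ^ P.d * (‖φ x‖ * ‖q (q (pdiff P.eps⁻¹ μ φ' x))‖) ∧
          ∀ i i' : ℕ,
            |rem322 P.eps q (gpiece P a msq k i) (gpiece P a msq k i') g g' φ φ'| ≤
              P.d * C * C * Q ^ 2 * H * (1 + 2 / δ) * (min (P.spacing i) (P.spacing i')) ^ α *
                ∑ x : Site P 0, ∑ x' : Site P 0, P.eps ^ (2 * P.d) *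
                  (‖φ x‖ * (P.spacing i ^ ((1 : ℝ) - (P.d : ℝ)) *
                      Real.exp (-(δ / 2 * (P.spacing i)⁻¹ * (P.eps * Site.tdist x x'))))
                    * (P.spacing i' ^ ((2 : ℝ) - (P.d : ℝ)) *
                      Real.exp (-(δ / 2 * (P.spacing i')⁻¹ * (P.eps * Site.tdist x x'))))) := by
  obtain ⟨δ, C, hδ, hC, Hk⟩ := gpiece_bounds 3 L (by norm_num) hL ha hmsq
  obtain ⟨C₁, C₂, hC₁, hC₂, H23⟩ := abs_expr323_eta_le_uniform.{u} L hL ha hmsq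
  refine ⟨δ, C, C₁, C₂, hδ, hC, hC₁, hC₂, ?_⟩
  intro P hPd hPL k hk1 hkK W _ _ α H Q K' hα0 hα1 hH hQ hK' q hq g g' hg hg' hlip φ φ' hφ'
  obtain ⟨hv, hrow, -, -⟩ := Hk P hPd hPL k hk1 hkK
  refine ⟨sum_expr321b_eq P.eps q k _ _ g g' φ φ', H23 P hPd hPL k hk1 hkK q K' hK' g g' φ φ' hg hg' hlip, fun i i' => ?_⟩
  exact abs_rem322_le P.eps P.eps_pos hα0 hα1 hH hQ hδ (P.spacing_pos i) (P.spacing_pos i') q hq _ _ g g' hg hg'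
    (fun μ x x' => hrow i μ x x') (hv i') φ φ' hφ'

end ZeroTorus

end

end Literature.MathematicalPhysics.QuantumFieldTheory.Balaban1983to89.B3Eq322PositiveDegree
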